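import Literature.AnabelianGeometry.EtaleTheta.Discharge.Sec4Thm44GaloisCompatibleOfEmbeddedBase
import Literature.AnabelianGeometry.SemiGraphs.ConnectedPartEquivExtension
import Literature.AnabelianGeometry.EtaleTheta.Discharge.Sec5OfConnectedTemperoid

/-!
# [EtTh] Thm. 4.4 (i): T44-L09 `HodotCompatible` and T44-L09c `GaloisCompatible` PROVED over the genuine base
# `D = B^temp(Π^tp_X)⁰` (abc-iut-L2-t4's `BiKummerSetting.mkOfConnectedTemperoid`) — no residual binder

S. Mochizuki, *The étale theta function and its Frobenioid-theoretic manifestations*, Publ. RIMS **45** (2009)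
[MochizukiEtTh2009], Thm. 4.4 (i) p.320 (PDF p.94) «`Ψ^bs` induces an isomorphism `H_{⊙,1} ⥲ H_{⊙,2}`, which is
well-defined up to composition with inner automorphisms of `Π^tp_{X_i}`»; proof p.321 (PDF p.95) ll.5–6 «follows
immediately from the theory of temperoids [cf. [SemiAnbd], Proposition 3.2; Theorem A.4]»; Def. 3.6 (ii) p.302
(PDF p.76): `D` «a connected, totally epimorphic category» — here `D = B^temp(Π^tp_X)⁰ = ConnectedPart (BTemp X.Pi)`.
S. Mochizuki, *Semi-graphs of anabelioids* [MochizukiSemiAnbd2006], Prop. 3.2 p.35, Rmk. 3.1.5 p.34.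

abc-iut cell, layer L2, ROW «SUBDAG-EtTh-Thm44 T44-L09 / T44-L09c AT THE TEMPEROID BASE via [SemiAnbd] Prop. 3.2»
(abc-iut-L2-lead gen 3 RULINGS #10; seat abc-iut-w5-d013 gen 3), FILE 5 = ASSEMBLY:
`Sec4Thm44GaloisCompatibleOfEmbeddedBase` (T44-L09/L09c for bases embedded in the temperoid, modulo an extension of
`Ψ^bs`) + `SemiGraphs/ConnectedPartEquivExtension` (`BTemp.exists_equivalence_extension`: every equivalence of
connected parts extends) ⇒ for bi-Kummer settings over `ConnectedPart (BTemp Xᵢ.Pi)` whose Galois data are the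
temperoid's (hypotheses `hg₁`/`hI₂`/`hg₂`, definitionally true for `mkOfConnectedTemperoid`) and ANY
`h : Thm44Hyp S₁ S₂`: **`h.HodotCompatible`** (T44-L09), **`h.GaloisCompatible`** (T44-L09c), `h.PreservesAmple`
(T44-L08), and `Thm44_i h` from «`C₂` Frobenioid» + T44-L03 alone; plus the literal `…_mkOfConnectedTemperoid`
instances.  Proof-only, no definition; nothing here bears on [IUTchIII] Cor. 3.12 (refereed pre-IUT material);
typed ≠ proved except for the theorems of this file.
-/

noncomputable section

namespace Literature.AnabelianGeometry.EtaleTheta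

open CategoryTheory Opposite Literature.AlgebraicGeometry.Frobenioids Literature.AnabelianGeometry.SemiGraphs
  Literature.AnabelianGeometry.SemiGraphs.GaloisObjects

namespace BiKummerSetting

universe u₀ v₀ w

variable {K : Type u₀} [Field K] {K' : Type u₀} [Field K'] {X₁ : SemiGraphs.TemperedArithmeticGroup.{u₀} K}
  {X₂ : SemiGraphs.TemperedArithmeticGroup.{u₀} K'} {D₀ : Type u₀} [Category.{v₀} D₀] {D₀' : Type u₀}
  [Category.{v₀} D₀'] {V : FrdIMonoidStub.{w}} {T₁ : RealifiedDivisorMonoids (D₀ := D₀) V}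
  {T₂ : RealifiedDivisorMonoids (D₀ := D₀') V}
  {VD₁ : FrdICatStub.{u₀ + 1, u₀, w} (ConnectedPart (BTemp X₁.Pi))}
  {VD₂ : FrdICatStub.{u₀ + 1, u₀, w} (ConnectedPart (BTemp X₂.Pi))}

section OfConnectedPart

variable {S₁ : BiKummerSetting X₁ T₁ (ConnectedPart (BTemp X₁.Pi)) VD₁}
  {S₂ : BiKummerSetting X₂ T₂ (ConnectedPart (BTemp X₂.Pi)) VD₂}

/-- **T44-L09 `HodotCompatible` over `B^temp(Π^tp_X)⁰`, NO residual binder**: for settings over the connected parts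
whose Galois data are the temperoid's, `θ(H_{⊙,1}) = H_{⊙,2}` for an isomorphism `θ : Π^tp_{X₁} ⥲ Π^tp_{X₂}` of
topological groups — the extension of `Ψ^bs` to the temperoids exists (`BTemp.exists_equivalence_extension`) and
[SemiAnbd] Prop. 3.2 pins it to `B^temp(φ)`. [cite: MochizukiEtTh2009, Thm 4.4 (i) p.320 (PDF p.94)] -/
theorem Thm44Hyp.hodotCompatible_ofConnectedPart (h : Thm44Hyp S₁ S₂)
    (hg₁ : ∀ (A : ConnectedPart (BTemp X₁.Pi)) (hA : S₁.IsGaloisObj A), ∃ hA' : SemiGraphs.IsGaloisObj A.obj,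
      ∀ g : X₁.Pi, (S₁.galoisSurj A hA g).hom.hom = (galoisSurjOf X₁.isTempered A.obj hA' g).hom)
    (hg₂ : ∀ (B : ConnectedPart (BTemp X₂.Pi)) (hB : S₂.IsGaloisObj B), ∃ hB' : SemiGraphs.IsGaloisObj B.obj,
      ∀ g : X₂.Pi, (S₂.galoisSurj B hB g).hom.hom = (galoisSurjOf X₂.isTempered B.obj hB' g).hom) :
    h.HodotCompatible := by
  obtain ⟨E, ⟨ηE⟩⟩ := BTemp.exists_equivalence_extension h.Ψbs
  exact h.hodotCompatible_ofEmbedded (connectedObjects (BTemp X₁.Pi)).ι (connectedObjects (BTemp X₂.Pi)).ι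
    hg₁ hg₂ E ηE

/-- **T44-L09c `GaloisCompatible` over `B^temp(Π^tp_X)⁰`, NO residual binder.**
[cite: MochizukiEtTh2009, Thm 4.4 (i) p.320 (PDF p.94)] -/
theorem Thm44Hyp.galoisCompatible_ofConnectedPart (h : Thm44Hyp S₁ S₂)
    (hg₁ : ∀ (A : ConnectedPart (BTemp X₁.Pi)) (hA : S₁.IsGaloisObj A), ∃ hA' : SemiGraphs.IsGaloisObj A.obj,
      ∀ g : X₁.Pi, (S₁.galoisSurj A hA g).hom.hom = (galoisSurjOf X₁.isTempered A.obj hA' g).hom)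
    (hI₂ : ∀ B : ConnectedPart (BTemp X₂.Pi), SemiGraphs.IsGaloisObj B.obj → S₂.IsGaloisObj B)
    (hg₂ : ∀ (B : ConnectedPart (BTemp X₂.Pi)) (hB : S₂.IsGaloisObj B), ∃ hB' : SemiGraphs.IsGaloisObj B.obj,
      ∀ g : X₂.Pi, (S₂.galoisSurj B hB g).hom.hom = (galoisSurjOf X₂.isTempered B.obj hB' g).hom) :
    h.GaloisCompatible := by
  obtain ⟨E, ⟨ηE⟩⟩ := BTemp.exists_equivalence_extension h.Ψbs
  exact h.galoisCompatible_ofEmbedded (connectedObjects (BTemp X₁.Pi)).ι (connectedObjects (BTemp X₂.Pi)).ι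
    hg₁ hI₂ hg₂ E ηE

/-- **T44-L08 `PreservesAmple` over `B^temp(Π^tp_X)⁰`.** [cite: MochizukiEtTh2009, Thm 4.4 (i) p.320 (PDF p.94)] -/
theorem Thm44Hyp.preservesAmple_ofConnectedPart (h : Thm44Hyp S₁ S₂)
    (hg₁ : ∀ (A : ConnectedPart (BTemp X₁.Pi)) (hA : S₁.IsGaloisObj A), ∃ hA' : SemiGraphs.IsGaloisObj A.obj,
      ∀ g : X₁.Pi, (S₁.galoisSurj A hA g).hom.hom = (galoisSurjOf X₁.isTempered A.obj hA' g).hom)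
    (hI₂ : ∀ B : ConnectedPart (BTemp X₂.Pi), SemiGraphs.IsGaloisObj B.obj → S₂.IsGaloisObj B)
    (hg₂ : ∀ (B : ConnectedPart (BTemp X₂.Pi)) (hB : S₂.IsGaloisObj B), ∃ hB' : SemiGraphs.IsGaloisObj B.obj,
      ∀ g : X₂.Pi, (S₂.galoisSurj B hB g).hom.hom = (galoisSurjOf X₂.isTempered B.obj hB' g).hom) :
    h.PreservesAmple :=
  h.preservesAmple_of (h.galoisCompatible_ofConnectedPart hg₁ hI₂ hg₂)

/-- **Thm. 4.4 (i) over `B^temp(Π^tp_X)⁰`** from «`C₂` is a Frobenioid» ([FrdI] Thm. 5.2 (ii)) and T44-L03 ([FrdI]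
Thm. 3.4) ONLY — the [SemiAnbd] inputs T44-L09 / T44-L09c of `thm44_i_of_inputs` are theorems here.
[cite: MochizukiEtTh2009, Thm 4.4 (i) p.320 (PDF p.94)] -/
theorem Thm44Hyp.thm44_i_ofConnectedPart (h : Thm44Hyp S₁ S₂)
    (hg₁ : ∀ (A : ConnectedPart (BTemp X₁.Pi)) (hA : S₁.IsGaloisObj A), ∃ hA' : SemiGraphs.IsGaloisObj A.obj,
      ∀ g : X₁.Pi, (S₁.galoisSurj A hA g).hom.hom = (galoisSurjOf X₁.isTempered A.obj hA' g).hom)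
    (hI₂ : ∀ B : ConnectedPart (BTemp X₂.Pi), SemiGraphs.IsGaloisObj B.obj → S₂.IsGaloisObj B)
    (hg₂ : ∀ (B : ConnectedPart (BTemp X₂.Pi)) (hB : S₂.IsGaloisObj B), ∃ hB' : SemiGraphs.IsGaloisObj B.obj,
      ∀ g : X₂.Pi, (S₂.galoisSurj B hB g).hom.hom = (galoisSurjOf X₂.isTempered B.obj hB' g).hom)
    (hF₂ : PreFrobenioid.IsFrobenioid S₂.F) (h3 : h.PreservesFrobeniusStructure) : Thm44_i h :=
  h.thm44_i_of_inputs hF₂ h3 (h.galoisCompatible_ofConnectedPart hg₁ hI₂ hg₂) (h.hodotCompatible_ofConnectedPart hg₁ hg₂)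

end OfConnectedPart

/-! ### The literal instances for abc-iut-L2-t4's `BiKummerSetting.mkOfConnectedTemperoid` -/

section MkOfConnectedTemperoid

variable (tf₁ : TemperedFrobenioid T₁ (ConnectedPart (BTemp X₁.Pi)) VD₁) (hZ₁ : tf₁.monoidType = MonoidType.Z)
  (hP₁ : ∀ A : (ConnectedPart (BTemp X₁.Pi))ᵒᵖ, IsPerfect (tf₁.Φ.carrier A))
  (NH₁ : Subgroup (Field.absoluteGaloisGroup K) → tf₁.category → ℕ+ → Prop) (A₁ : tf₁.category)
  (hA₁ : PreFrobenioid.IsFrobeniusTrivial tf₁.toElem A₁) (hA₁' : SemiGraphs.IsGaloisObj A₁.base.obj)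
  (tf₂ : TemperedFrobenioid T₂ (ConnectedPart (BTemp X₂.Pi)) VD₂) (hZ₂ : tf₂.monoidType = MonoidType.Z)
  (hP₂ : ∀ B : (ConnectedPart (BTemp X₂.Pi))ᵒᵖ, IsPerfect (tf₂.Φ.carrier B))
  (NH₂ : Subgroup (Field.absoluteGaloisGroup K') → tf₂.category → ℕ+ → Prop) (A₂ : tf₂.category)
  (hA₂ : PreFrobenioid.IsFrobeniusTrivial tf₂.toElem A₂) (hA₂' : SemiGraphs.IsGaloisObj A₂.base.obj)

/-- **T44-L09 `HodotCompatible` for the settings `mkOfConnectedTemperoid` — UNCONDITIONAL.**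
[cite: MochizukiEtTh2009, Thm 4.4 (i) p.320 (PDF p.94)] -/
theorem Thm44Hyp.hodotCompatible_mkOfConnectedTemperoid
    (h : Thm44Hyp (mkOfConnectedTemperoid X₁ tf₁ hZ₁ hP₁ NH₁ A₁ hA₁ hA₁')
      (mkOfConnectedTemperoid X₂ tf₂ hZ₂ hP₂ NH₂ A₂ hA₂ hA₂')) : h.HodotCompatible :=
  h.hodotCompatible_ofConnectedPart (fun _ hA => ⟨hA, fun _ => rfl⟩) (fun _ hB => ⟨hB, fun _ => rfl⟩)

/-- **T44-L09c `GaloisCompatible` for the settings `mkOfConnectedTemperoid` — UNCONDITIONAL.**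
[cite: MochizukiEtTh2009, Thm 4.4 (i) p.320 (PDF p.94)] -/
theorem Thm44Hyp.galoisCompatible_mkOfConnectedTemperoid
    (h : Thm44Hyp (mkOfConnectedTemperoid X₁ tf₁ hZ₁ hP₁ NH₁ A₁ hA₁ hA₁')
      (mkOfConnectedTemperoid X₂ tf₂ hZ₂ hP₂ NH₂ A₂ hA₂ hA₂')) : h.GaloisCompatible :=
  h.galoisCompatible_ofConnectedPart (fun _ hA => ⟨hA, fun _ => rfl⟩) (fun _ hB => hB) (fun _ hB => ⟨hB, fun _ => rfl⟩)

/-- **T44-L08 `PreservesAmple` for the settings `mkOfConnectedTemperoid`.** [cite: MochizukiEtTh2009, Thm 4.4 (i) p.320 (PDF p.94)] -/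
theorem Thm44Hyp.preservesAmple_mkOfConnectedTemperoid
    (h : Thm44Hyp (mkOfConnectedTemperoid X₁ tf₁ hZ₁ hP₁ NH₁ A₁ hA₁ hA₁')
      (mkOfConnectedTemperoid X₂ tf₂ hZ₂ hP₂ NH₂ A₂ hA₂ hA₂')) : h.PreservesAmple :=
  h.preservesAmple_ofConnectedPart (fun _ hA => ⟨hA, fun _ => rfl⟩) (fun _ hB => hB) (fun _ hB => ⟨hB, fun _ => rfl⟩)

/-- **Thm. 4.4 (i) for the settings `mkOfConnectedTemperoid`** from «`C₂` is a Frobenioid» and T44-L03 only.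
[cite: MochizukiEtTh2009, Thm 4.4 (i) p.320 (PDF p.94)] -/
theorem Thm44Hyp.thm44_i_mkOfConnectedTemperoid
    (h : Thm44Hyp (mkOfConnectedTemperoid X₁ tf₁ hZ₁ hP₁ NH₁ A₁ hA₁ hA₁')
      (mkOfConnectedTemperoid X₂ tf₂ hZ₂ hP₂ NH₂ A₂ hA₂ hA₂'))
    (hF₂ : PreFrobenioid.IsFrobenioid (mkOfConnectedTemperoid X₂ tf₂ hZ₂ hP₂ NH₂ A₂ hA₂ hA₂').F)
    (h3 : h.PreservesFrobeniusStructure) : Thm44_i h :=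
  h.thm44_i_ofConnectedPart (fun _ hA => ⟨hA, fun _ => rfl⟩) (fun _ hB => hB) (fun _ hB => ⟨hB, fun _ => rfl⟩) hF₂ h3

end MkOfConnectedTemperoid

end BiKummerSetting

end Literature.AnabelianGeometry.EtaleTheta

end
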